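import Summits.Ventures.PercRepro.ProfileGapMonoQ

/-!
# PercRepro — THE GAP-MONOTONICITY CONJECTURE HOLDS AT THE TOP LEVEL (p10, gen 7; `proofs/P10-AVFULL.md` §10)

At the level `u = ρ(E)` the co-rank-`q` gap of a finite matroid is deletion-monotone at EVERY point:
`GapMonoQ M z q (rk M (gr M))` for every `z` and every `q ≤ ρ(E)`.  The proof is the complement injection of the
top level: a rank-`q` set `B` with spanning complement goes to `E ∖ B` or to `(E ∖ B) ∪ z` according to whether
`z` is a coloop of `B`, and the sets of `M ∖ z` go to themselves.  This is the first kernel instance of the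
conjecture of record of ProfileGapMonoQ (the levels `u < ρ(E)` are open).

* `levelSetCoQ_delete_eq_filter`, `demand_top_eq`, `demand_delete_top_eq`;
* `sdiff_sdiff_self_of_subset`, `sdiff_insert_sdiff_eq_erase`, `rk_eq_q_of_mem_Rq`,
  `rk_eq_of_mem_levelSetCoQ`, `eRk_eq_of_rk_eq`, `rk_le_rk_gr`, `topMap`;
* **`gapMonoQ_top`** — `GapMonoQ M z q (rk M (gr M))` for every `z ∈ E` and every `q < ρ(E)`; `gapMonoQ_of_rk_eq`.
-/

open scoped Matroid

namespace PercRepro.Cogirth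

open Finset ThmH Skew Shadow Profile

variable {α : Type} [DecidableEq α] {M : Matroid α} [M.Finite]

/-- The co-rank-`q` rank-`u` sets of `M ∖ z`, read in `M`. -/
theorem levelSetCoQ_delete_eq_filter (z : α) (q u : ℕ) :
    levelSetCoQ (M ＼ ({z} : Set α)) q u =
      (levelSetCoQ M q u).filter (fun S => z ∉ S ∧ q ≤ rk M ((gr M \ S).erase z)) := by
  ext S
  rw [mem_filter, mem_levelSetCoQ, mem_levelSetCoQ, gr_delete']
  constructor
  · rintro ⟨⟨hS, hr⟩, h3⟩
    have hzS : z ∉ S := fun h => (mem_erase.1 (hS h)).1 rfl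
    have hS' : S ⊆ gr M := (subset_erase.1 hS).1
    rw [delete_singleton_eRk_eq (by rw [← coe_gr, ← Finset.coe_erase]; exact_mod_cast hS)] at hr
    rw [erase_sdiff, rk_delete (erase_subset_erase z sdiff_subset)] at h3
    refine ⟨⟨⟨hS', hr⟩, ?_⟩, hzS, h3⟩
    exact h3.trans (rk_mono_sub (erase_subset z _))
  · rintro ⟨⟨⟨hS, hr⟩, _⟩, hzS, h3⟩
    have hS' : S ⊆ (gr M).erase z := subset_erase.2 ⟨hS, hzS⟩
    refine ⟨⟨hS', ?_⟩, ?_⟩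
    · rw [delete_singleton_eRk_eq (by rw [← coe_gr, ← Finset.coe_erase]; exact_mod_cast hS')]
      exact hr
    · rw [erase_sdiff, rk_delete (erase_subset_erase z sdiff_subset)]
      exact h3

/-- At the top level the demand of a rank-`q` set is `C(ρ(E), q)` if its complement spans and `0` otherwise. -/
theorem demand_top_eq {q : ℕ} (hq : q ≤ rk M (gr M)) (B : Finset α) :
    demand M q (rk M (gr M)) B =
      if rk M (gr M \ B) = rk M (gr M) then (rk M (gr M)).choose q else 0 := by
  unfold demand
  have hle : rk M (gr M \ B) ≤ rk M (gr M) := rk_mono_sub sdiff_subset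
  by_cases h : rk M (gr M \ B) = rk M (gr M)
  · rw [if_pos h, if_pos (by omega), h, Nat.choose_symm hq]
  · rw [if_neg h, if_neg (by omega)]

/-- At the top level the demand in `M ∖ z` of a set `B ∌ z` is `C(ρ(E), q)` if `E ∖ B ∖ z` spans `M`, else `0`. -/
theorem demand_delete_top_eq {q : ℕ} (hq : q ≤ rk M (gr M)) (B : Finset α) (z : α) :
    demand (M ＼ ({z} : Set α)) q (rk M (gr M)) B =
      if rk M ((gr M \ B).erase z) = rk M (gr M) then (rk M (gr M)).choose q else 0 := by
  rw [demand_delete_eq_ite']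
  have hle : rk M ((gr M \ B).erase z) ≤ rk M (gr M) :=
    rk_mono_sub ((erase_subset z _).trans sdiff_subset)
  by_cases h : rk M ((gr M \ B).erase z) = rk M (gr M)
  · rw [if_pos h, if_pos (by omega), h, Nat.choose_symm hq]
  · rw [if_neg h, if_neg (by omega)]

/-! ### Set identities and rank facts for the complement injection -/

/-- `E ∖ (E ∖ B) = B` for `B ⊆ E`. -/
theorem sdiff_sdiff_self_of_subset {B : Finset α} (hB : B ⊆ gr M) : gr M \ (gr M \ B) = B :=
  Finset.sdiff_sdiff_eq_self hB

/-- `E ∖ insert z (E ∖ B) = B.erase z` for `B ⊆ E`. -/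
theorem sdiff_insert_sdiff_eq_erase {B : Finset α} (hB : B ⊆ gr M) (z : α) :
    gr M \ insert z (gr M \ B) = B.erase z := by
  ext x
  simp only [mem_sdiff, mem_insert, mem_erase, not_or, not_and, not_not]
  constructor
  · rintro ⟨hxE, hxz, hxB⟩
    exact ⟨hxz, hxB hxE⟩
  · rintro ⟨hxz, hxB⟩
    exact ⟨hB hxB, hxz, fun _ => hxB⟩

omit [DecidableEq α] in
/-- A rank-`q` set of `M` has natural rank `q`. -/
theorem rk_eq_q_of_mem_Rq {q : ℕ} {B : Finset α} (hB : B ∈ Rq M q) : rk M B = q := by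
  rw [mem_Rq] at hB
  unfold rk
  rw [hB.2, ENat.toNat_coe]

/-- A member of `levelSetCoQ M q u` has natural rank `u`. -/
theorem rk_eq_of_mem_levelSetCoQ {q u : ℕ} {S : Finset α} (hS : S ∈ levelSetCoQ M q u) : rk M S = u := by
  rw [mem_levelSetCoQ] at hS
  unfold rk
  rw [hS.1.2, ENat.toNat_coe]

omit [DecidableEq α] in
/-- `eRk` from the natural rank. -/
theorem eRk_eq_of_rk_eq {S : Finset α} {u : ℕ} (h : rk M S = u) : M.eRk (S : Set α) = (u : ℕ∞) := by
  rw [← coe_rk, h]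

omit [DecidableEq α] in
/-- Subsets of the ground set have rank at most `ρ(E)`. -/
theorem rk_le_rk_gr {X : Finset α} (hX : X ⊆ gr M) : rk M X ≤ rk M (gr M) := rk_mono_sub hX

/-! ### The complement injection at the top level -/

/-- The map of the top-level injection: a rank-`ρ(E)` set goes to itself; a rank-`q` set `B` avoiding `z` goes to
itself if `E ∖ B ∖ z` still spans and to `E ∖ B` otherwise; a rank-`q` set `B ∋ z` goes to `(E ∖ B) ∪ z` if `z` is
not a coloop of `B` and to `E ∖ B` if it is. -/
noncomputable def topMap (M : Matroid α) [M.Finite] (z : α) (q : ℕ) (X : Finset α) : Finset α :=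
  if rk M X = rk M (gr M) then X
  else if z ∈ X then (if rk M (X.erase z) = q then insert z (gr M \ X) else gr M \ X)
  else (if rk M ((gr M \ X).erase z) = rk M (gr M) then X else gr M \ X)

/-- **The gap-monotonicity conjecture at the top level**: `GapMonoQ M z q (ρ(E))` for every `z ∈ E`, `q < ρ(E)`. -/
theorem gapMonoQ_top {q : ℕ} (hq : q < rk M (gr M)) (z : α) (hz : z ∈ gr M) :
    GapMonoQ M z q (rk M (gr M)) := by
  have hqR : q ≤ rk M (gr M) := hq.le
  unfold GapMonoQ
  have hD : ∑ B ∈ Rq M q, demand M q (rk M (gr M)) B =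
      (rk M (gr M)).choose q * ((Rq M q).filter (fun B => rk M (gr M \ B) = rk M (gr M))).card := by
    rw [sum_congr rfl (fun B _ => demand_top_eq hqR B), ← sum_filter, sum_const, smul_eq_mul, mul_comm]
  have hD' : ∑ B ∈ Rq (M ＼ ({z} : Set α)) q, demand (M ＼ ({z} : Set α)) q (rk M (gr M)) B =
      (rk M (gr M)).choose q *
        ((Rq M q).filter (fun B => z ∉ B ∧ rk M ((gr M \ B).erase z) = rk M (gr M))).card := by
    rw [Rq_delete_eq_filter, sum_congr rfl (fun B _ => demand_delete_top_eq hqR B z), ← sum_filter,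
      filter_filter, sum_const, smul_eq_mul, mul_comm]
  rw [hD, hD', levelSetCoQ_delete_eq_filter, ← mul_add, ← mul_add]
  apply Nat.mul_le_mul_left
  -- the four families
  have hA : ∀ B ∈ (Rq M q).filter (fun B => rk M (gr M \ B) = rk M (gr M)),
      B ⊆ gr M ∧ rk M B = q ∧ rk M (gr M \ B) = rk M (gr M) := by
    intro B hB
    rw [mem_filter] at hB
    exact ⟨(mem_Rq.1 hB.1).1, rk_eq_q_of_mem_Rq hB.1, hB.2⟩
  have hS' : ∀ X ∈ (levelSetCoQ M q (rk M (gr M))).filter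
      (fun S => z ∉ S ∧ q ≤ rk M ((gr M \ S).erase z)),
      X ⊆ gr M ∧ rk M X = rk M (gr M) ∧ z ∉ X ∧ q ≤ rk M ((gr M \ X).erase z) := by
    intro X hX
    rw [mem_filter] at hX
    exact ⟨(mem_levelSetCoQ.1 hX.1).1.1, rk_eq_of_mem_levelSetCoQ hX.1, hX.2.1, hX.2.2⟩
  -- disjointness of the two pairs (rank `q` versus rank `ρ(E)`)
  have hdisj1 : Disjoint ((Rq M q).filter (fun B => rk M (gr M \ B) = rk M (gr M)))
      ((levelSetCoQ M q (rk M (gr M))).filter (fun S => z ∉ S ∧ q ≤ rk M ((gr M \ S).erase z))) := by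
    rw [disjoint_left]
    intro X h1 h2
    have := (hA X h1).2.1
    have := (hS' X h2).2.1
    omega
  have hdisj2 : Disjoint ((Rq M q).filter (fun B => z ∉ B ∧ rk M ((gr M \ B).erase z) = rk M (gr M)))
      (levelSetCoQ M q (rk M (gr M))) := by
    rw [disjoint_left]
    intro X h1 h2
    have h1' := rk_eq_q_of_mem_Rq (mem_filter.1 h1).1
    have h2' := rk_eq_of_mem_levelSetCoQ h2
    omega
  rw [← card_union_of_disjoint hdisj1, ← card_union_of_disjoint hdisj2]
  -- membership of the images
  have hmemS : ∀ {Y : Finset α}, Y ⊆ gr M → rk M Y = rk M (gr M) → q ≤ rk M (gr M \ Y) →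
      Y ∈ levelSetCoQ M q (rk M (gr M)) := by
    intro Y hY hr hq'
    rw [mem_levelSetCoQ]
    exact ⟨⟨hY, eRk_eq_of_rk_eq hr⟩, hq'⟩
  apply card_le_card_of_injOn (topMap M z q)
  · -- maps to
    intro X hX
    rw [mem_coe, mem_union] at hX
    rw [mem_coe, mem_union]
    rcases hX with hX | hX
    · obtain ⟨hBE, hrB, hrc⟩ := hA X hX
      have hne : rk M X ≠ rk M (gr M) := by omega
      unfold topMap
      rw [if_neg hne]
      by_cases hzX : z ∈ X
      · rw [if_pos hzX]
        by_cases hcol : rk M (X.erase z) = q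
        · rw [if_pos hcol]
          right
          apply hmemS
          · exact insert_subset hz sdiff_subset
          · apply le_antisymm (rk_le_rk_gr (insert_subset hz sdiff_subset))
            rw [← hrc]
            exact rk_mono_sub (subset_insert _ _)
          · rw [sdiff_insert_sdiff_eq_erase hBE, hcol]
        · rw [if_neg hcol]
          right
          apply hmemS sdiff_subset hrc
          rw [sdiff_sdiff_self_of_subset hBE, hrB]
      · rw [if_neg hzX]
        by_cases hsp : rk M ((gr M \ X).erase z) = rk M (gr M)
        · rw [if_pos hsp]
          left
          rw [mem_filter]
          exact ⟨(mem_filter.1 hX).1, hzX, hsp⟩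
        · rw [if_neg hsp]
          right
          apply hmemS sdiff_subset hrc
          rw [sdiff_sdiff_self_of_subset hBE, hrB]
    · obtain ⟨hXE, hrX, hzX, hqX⟩ := hS' X hX
      unfold topMap
      rw [if_pos hrX]
      right
      apply hmemS hXE hrX
      exact hqX.trans (rk_mono_sub (erase_subset z _))
  · -- injective
    intro X hX Y hY hXY
    rw [mem_coe, mem_union] at hX hY
    -- the rank of an image identifies its type; `z ∈ gr M \ W ↔ z ∉ W` for `W ⊆ gr M`
    have hzc : ∀ {W : Finset α}, W ⊆ gr M → (z ∈ gr M \ W ↔ z ∉ W) := by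
      intro W _
      rw [mem_sdiff]
      exact ⟨fun h => h.2, fun h => ⟨hz, h⟩⟩
    have hrk_sdiff : ∀ {W : Finset α}, W ⊆ gr M → rk M (gr M \ W) = rk M (gr M) →
        rk M (insert z (gr M \ W)) = rk M (gr M) := by
      intro W _ hW
      apply le_antisymm (rk_le_rk_gr (insert_subset hz sdiff_subset))
      rw [← hW]
      exact rk_mono_sub (subset_insert _ _)
    rcases hX with hX | hX <;> rcases hY with hY | hY
    · -- both of type A
      obtain ⟨hXE, hrX, hrcX⟩ := hA X hX
      obtain ⟨hYE, hrY, hrcY⟩ := hA Y hY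
      have hneX : rk M X ≠ rk M (gr M) := by omega
      have hneY : rk M Y ≠ rk M (gr M) := by omega
      unfold topMap at hXY
      rw [if_neg hneX, if_neg hneY] at hXY
      split_ifs at hXY with h1 h2 h3 h4 h5 h6 h7 h8
      -- (z ∈ X, z non-coloop) vs (z ∈ Y, z non-coloop): `insert z (E∖X) = insert z (E∖Y)`
      · have hzX' : z ∉ gr M \ X := fun h => (hzc hXE).1 h h1
        have hzY' : z ∉ gr M \ Y := fun h => (hzc hYE).1 h h3
        have h := congrArg (fun W => W.erase z) hXY
        simp only [erase_insert hzX', erase_insert hzY'] at h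
        rw [← sdiff_sdiff_self_of_subset hXE, h, sdiff_sdiff_self_of_subset hYE]
      -- (z ∈ X, non-coloop) vs (z ∈ Y, coloop): `insert z (E∖X) = E∖Y` with `z ∈ Y` — impossible
      · exfalso
        have hzY' : z ∉ gr M \ Y := fun h => (hzc hYE).1 h h3
        rw [← hXY] at hzY'
        exact hzY' (mem_insert_self _ _)
      -- (z ∈ X, non-coloop) vs (z ∉ Y, spanning after erase): `insert z (E∖X) = Y` — rank `ρ(E)` vs `q`
      · exfalso
        have := congrArg (rk M) hXY
        rw [hrk_sdiff hXE hrcX, hrY] at this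
        omega
      -- (z ∈ X, non-coloop) vs (z ∉ Y, not spanning after erase): `insert z (E∖X) = E∖Y`; erase `z`
      · exfalso
        have hzX' : z ∉ gr M \ X := fun h => (hzc hXE).1 h h1
        have h := congrArg (fun W => W.erase z) hXY
        simp only [erase_insert hzX'] at h
        apply h5
        rw [← h, hrcX]
      -- (z ∈ X, coloop) vs (z ∈ Y, non-coloop): `E∖X = insert z (E∖Y)` with `z ∈ X` — impossible
      · exfalso
        have hzX' : z ∉ gr M \ X := fun h => (hzc hXE).1 h h1
        rw [hXY] at hzX'
        exact hzX' (mem_insert_self _ _)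
      -- (z ∈ X, coloop) vs (z ∈ Y, coloop): `E∖X = E∖Y`
      · rw [← sdiff_sdiff_self_of_subset hXE, hXY, sdiff_sdiff_self_of_subset hYE]
      -- (z ∈ X, coloop) vs (z ∉ Y, spanning): `E∖X = Y` — rank `ρ(E)` vs `q`
      · exfalso
        have := congrArg (rk M) hXY
        rw [hrcX, hrY] at this
        omega
      -- (z ∈ X, coloop) vs (z ∉ Y, not spanning): `E∖X = E∖Y` but `z ∈ X`, `z ∉ Y`
      · exfalso
        have hzX' : z ∉ gr M \ X := fun h => (hzc hXE).1 h h1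
        rw [hXY] at hzX'
        exact hzX' ((hzc hYE).2 h6)
      -- (z ∉ X, spanning) vs (z ∈ Y, non-coloop): `X = insert z (E∖Y)` — rank `q` vs `ρ(E)`
      · exfalso
        have := congrArg (rk M) hXY
        rw [hrX, hrk_sdiff hYE hrcY] at this
        omega
      -- (z ∉ X, spanning) vs (z ∈ Y, coloop): `X = E∖Y` — rank `q` vs `ρ(E)`
      · exfalso
        have := congrArg (rk M) hXY
        rw [hrX, hrcY] at this
        omega
      -- (z ∉ X, spanning) vs (z ∉ Y, spanning): `X = Y`
      · exact hXY
      -- (z ∉ X, spanning) vs (z ∉ Y, not spanning): `X = E∖Y` — rank `q` vs `ρ(E)`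
      · exfalso
        have := congrArg (rk M) hXY
        rw [hrX, hrcY] at this
        omega
      -- (z ∉ X, not spanning) vs (z ∈ Y, non-coloop): `E∖X = insert z (E∖Y)`; erase `z`
      · exfalso
        have hzY' : z ∉ gr M \ Y := fun h => (hzc hYE).1 h ‹z ∈ Y›
        have h := congrArg (fun W => W.erase z) hXY
        simp only [erase_insert hzY'] at h
        apply ‹¬ rk M ((gr M \ X).erase z) = rk M (gr M)›
        rw [h, hrcY]
      -- (z ∉ X, not spanning) vs (z ∈ Y, coloop): `E∖X = E∖Y` but `z ∉ X`, `z ∈ Y`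
      · exfalso
        have hzY' : z ∉ gr M \ Y := fun h => (hzc hYE).1 h ‹z ∈ Y›
        rw [← hXY] at hzY'
        exact hzY' ((hzc hXE).2 ‹z ∉ X›)
      -- (z ∉ X, not spanning) vs (z ∉ Y, spanning): `E∖X = Y` — rank `ρ(E)` vs `q`
      · exfalso
        have := congrArg (rk M) hXY
        rw [hrcX, hrY] at this
        omega
      -- (z ∉ X, not spanning) vs (z ∉ Y, not spanning): `E∖X = E∖Y`
      · rw [← sdiff_sdiff_self_of_subset hXE, hXY, sdiff_sdiff_self_of_subset hYE]
    · -- X of type A, Y of type S'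
      obtain ⟨hXE, hrX, hrcX⟩ := hA X hX
      obtain ⟨hYE, hrY, hzY, hqY⟩ := hS' Y hY
      have hneX : rk M X ≠ rk M (gr M) := by omega
      unfold topMap at hXY
      rw [if_neg hneX, if_pos hrY] at hXY
      exfalso
      split_ifs at hXY with h1 h2 h3
      · -- `insert z (E∖X) = Y` but `z ∉ Y`
        rw [← hXY] at hzY
        exact hzY (mem_insert_self _ _)
      · -- `E∖X = Y` with `z ∈ X` a coloop of `X`: `q ≤ rk((E∖Y).erase z) = rk(X.erase z) < q`
        have hXz : (gr M \ Y).erase z = X.erase z := by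
          rw [← hXY, sdiff_sdiff_self_of_subset hXE]
        rw [hXz] at hqY
        have hle : rk M (X.erase z) ≤ rk M X := rk_mono_sub (erase_subset z X)
        omega
      · -- `X = Y` — rank `q` vs `ρ(E)`
        have := congrArg (rk M) hXY
        omega
      · -- `E∖X = Y` with `z ∉ X`: `z ∈ E∖X = Y`, but `z ∉ Y`
        rw [← hXY] at hzY
        exact hzY ((hzc hXE).2 h1)
    · -- X of type S', Y of type A (the mirror)
      obtain ⟨hXE, hrX, hzX, hqX⟩ := hS' X hX
      obtain ⟨hYE, hrY, hrcY⟩ := hA Y hY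
      have hneY : rk M Y ≠ rk M (gr M) := by omega
      unfold topMap at hXY
      rw [if_pos hrX, if_neg hneY] at hXY
      exfalso
      split_ifs at hXY with h1 h2 h3
      · rw [hXY] at hzX
        exact hzX (mem_insert_self _ _)
      · have hYz : (gr M \ X).erase z = Y.erase z := by
          rw [hXY, sdiff_sdiff_self_of_subset hYE]
        rw [hYz] at hqX
        have hle : rk M (Y.erase z) ≤ rk M Y := rk_mono_sub (erase_subset z Y)
        omega
      · have := congrArg (rk M) hXY
        omega
      · rw [hXY] at hzX
        exact hzX ((hzc hYE).2 h1)
    · -- both of type S'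
      obtain ⟨_, hrX, _, _⟩ := hS' X hX
      obtain ⟨_, hrY, _, _⟩ := hS' Y hY
      unfold topMap at hXY
      rw [if_pos hrX, if_pos hrY] at hXY
      exact hXY

/-- The same, for a level equal to the rank: `GapMonoQ M z q u` whenever `u = ρ(E)` and `q < u`. -/
theorem gapMonoQ_of_rk_eq {q u : ℕ} (hu : rk M (gr M) = u) (hq : q < u) (z : α) (hz : z ∈ gr M) :
    GapMonoQ M z q u := by
  subst hu
  exact gapMonoQ_top hq z hz

end PercRepro.Cogirth
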